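import Literature.Probability.Percolation.VerticalSweepTwoSided
import Literature.Probability.Percolation.OptimalWitness
import Literature.Probability.Percolation.ChainTailBoundBinomial
import HarnessLib

/-!
# Transport of vertical crossings through the irregular block (GM14 Proposition 6.8) — I:
# the `N²` track exchanges, their levels and laws

Grimmett–Manolescu, *Bond percolation on isoradial graphs* (PTRF 159 (2014) 273–327 =
arXiv:1204.0505), §6.3: in `G_{α,β̃}` (`β̃_j = ξ` for `j < N`, the regular block, `β̃_{N+i} = β_i`,
the irregular block) "the tracks of the regular block are moved upwards by a process of
track-exchange […] `V_k = Σ_{2N-k} ∘ ⋯ ∘ Σ_{N-k+1}` (6.29). The map `V_k` exchanges the track at level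
`N - k` with the `N` tracks immediately above it. The sequential action of `V_0, V_1, …, V_{N-1}`
moves the regular block upwards track by track."

This file sets up this process on the strip of `TrackExchangeStrip`: the data `VData`
(`M, α, β, ξ, N`), the row angles `rowV k s` after `k` blocks and `s` exchanges of the current
block, the exchange data `DV k s` of the next exchange (levels `N-1-k+s` (the ascending regular
track, angle `ξ`) and `N-k+s` (angle `β_s`)), and proves the bookkeeping identities
(`DV_lo`, `DV_up`, `βExchanged_DV` : the exchanged rows are `rowV k (s+1)`, `rowV_block` : the rows
after a block are the initial rows of the next one), the time-indexed versions `Dt t = DV (t/N) (t%N)`,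
`weightsT`, `exchanged_Dt` and the one-step law `map_stepV` (`P_t ⊗ noise ↦ P_{t+1}`, from
`map_sweep₂`). The final rows `rowV N 0` carry `β_0, …, β_{N-1}` on the levels `0, …, N-1`
(`rowV_final`), the initial ones `ξ` on the levels `< N` (`rowV_initial`).

Indexing note: the printed `V_k` would, with `β̃` as printed, lift the track at level `N` (angle
`β_0`); the intended process lifts the regular tracks at levels `N-1, N-2, …, 0`, which is what is
implemented here (block `k` lifts the track from level `N-1-k` through the `N` tracks above it).

## References

* G. R. Grimmett, I. Manolescu, PTRF 159 (2014) 273–327, arXiv:1204.0505, §6.1 (`β̃`), §6.3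
  ((6.29), the process `V_0, …, V_{N-1}`).
-/

noncomputable section

namespace Literature.Probability.Percolation

open LatticeModels StarTriangle Real MeasureTheory

namespace TrackExchange

/-- **The data of the vertical transport**: the strip half-width `M`, column angles `α`, the
angles `β_0, β_1, …` of the irregular block, the regular angle `ξ`, and the height `N` of the
regular block (also the number of blocks and of exchanges per block). [cite: GrimmettManolescu2014Isoradial, §6.3] -/
structure VData where
  /-- Half-width of the strip. -/
  M : ℕ
  /-- Transverse angles of the column tracks. -/
  α : ℤ → ℝ
  /-- Transverse angles of the irregular block. -/
  β : ℕ → ℝ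
  /-- The regular angle. -/
  ξ : ℝ
  /-- Height of the regular block. -/
  N : ℕ

namespace VData

variable (V : VData)

/-- **The row angles after `k` blocks and `s` exchanges of block `k`**: regular tracks `ξ` below
level `N-1-k`; the ascending regular track at level `N-1-k+s`; `β_0, …, β_{s-1}` (already passed,
one level down) at levels `N-1-k, …`; `β_s, …, β_{N-1}` at levels `N-k+s, …, 2N-1-k`; the `k` risen
regular tracks at levels `2N-k, …, 2N-1`; the rest of the irregular block above.
[cite: GrimmettManolescu2014Isoradial, §6.3] -/
def rowV (k s : ℕ) (y : ℤ) : ℝ :=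
  if y < (V.N : ℤ) - 1 - k then V.ξ
  else if y = (V.N : ℤ) - 1 - k + s then V.ξ
  else if y ≤ 2 * (V.N : ℤ) - 1 - k then
    (if y < (V.N : ℤ) - 1 - k + s then V.β (y - ((V.N : ℤ) - 1 - k)).toNat else V.β (y - ((V.N : ℤ) - k)).toNat)
  else if y ≤ 2 * (V.N : ℤ) - 1 then V.ξ
  else V.β (y - V.N).toNat

/-- The upper level of the `s`-th exchange of block `k`: `N - k + s`. [cite: GrimmettManolescu2014Isoradial, §6.3 (6.29)] -/
def level (k s : ℕ) : ℤ := (V.N : ℤ) - k + s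

/-- **The exchange data of the `s`-th exchange of block `k`.** [cite: GrimmettManolescu2014Isoradial, §6.3 (6.29)] -/
@[reducible] def DV (k s : ℕ) : ExchangeData := { M := V.M, α := V.α, β := V.rowV k s, j := V.level k s }

/-- The lower track exchanged is the ascending regular one. [cite: GrimmettManolescu2014Isoradial, §6.3] -/
theorem DV_lo (k s : ℕ) : (V.DV k s).lo = V.ξ := by
  show V.rowV k s (V.level k s - 1) = V.ξ
  unfold rowV level
  rw [if_neg (by omega), if_pos (by omega)]

/-- The upper track exchanged carries `β_s`. [cite: GrimmettManolescu2014Isoradial, §6.3] -/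
theorem DV_up {k s : ℕ} (hs : s < V.N) : (V.DV k s).up = V.β s := by
  show V.rowV k s (V.level k s) = V.β s
  unfold rowV level
  rw [if_neg (by omega), if_neg (by omega), if_pos (by omega), if_neg (by omega)]
  congr 1; omega

/-- **The exchanged rows are the rows of the next time.** [cite: GrimmettManolescu2014Isoradial, §6.3] -/
theorem βExchanged_DV {k s : ℕ} (hs : s < V.N) : (V.DV k s).βExchanged = V.rowV k (s + 1) := by
  funext y
  show (V.rowV k s ∘ Equiv.swap (V.level k s - 1) (V.level k s)) y = V.rowV k (s + 1) y
  rw [Function.comp_apply]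
  unfold level
  by_cases h1 : y = (V.N : ℤ) - k + s - 1
  · rw [h1, Equiv.swap_apply_left]
    unfold rowV
    push_cast
    split_ifs <;> first | rfl | (exfalso; omega) | (congr 1; omega)
  · by_cases h2 : y = (V.N : ℤ) - k + s
    · rw [h2, Equiv.swap_apply_right]
      unfold rowV
      push_cast
      split_ifs <;> first | rfl | (exfalso; omega)
    · rw [Equiv.swap_apply_of_ne_of_ne h1 h2]
      unfold rowV
      push_cast
      split_ifs <;> first | rfl | (exfalso; omega)

/-- **The rows after block `k` are the initial rows of block `k + 1`.** [cite: GrimmettManolescu2014Isoradial, §6.3] -/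
theorem rowV_block (k : ℕ) : V.rowV k V.N = V.rowV (k + 1) 0 := by
  funext y
  unfold rowV
  push_cast
  split_ifs <;> first | rfl | (exfalso; omega) | (congr 1; omega)

/-- With equal angles nothing changes. [folklore] -/
theorem rowV_succ_of_eq {k s : ℕ} (hs : s < V.N) (h : V.β s = V.ξ) : V.rowV k (s + 1) = V.rowV k s := by
  rw [← V.βExchanged_DV hs]
  funext y
  show (V.rowV k s ∘ Equiv.swap (V.level k s - 1) (V.level k s)) y = V.rowV k s y
  rw [Function.comp_apply]
  by_cases h1 : y = V.level k s - 1
  · rw [h1, Equiv.swap_apply_left]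
    change (V.DV k s).up = (V.DV k s).lo
    rw [V.DV_up hs, V.DV_lo, h]
  · by_cases h2 : y = V.level k s
    · rw [h2, Equiv.swap_apply_right]
      change (V.DV k s).lo = (V.DV k s).up
      rw [V.DV_up hs, V.DV_lo, h]
    · rw [Equiv.swap_apply_of_ne_of_ne h1 h2]

/-- **The initial rows**: `ξ` on all levels `< N` (the regular block), `β_{y-N}` above. [cite: GrimmettManolescu2014Isoradial, §6.1] -/
theorem rowV_initial (y : ℤ) : V.rowV 0 0 y = if y < V.N then V.ξ else V.β (y - V.N).toNat := by
  unfold rowV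
  push_cast
  split_ifs <;> first | rfl | (exfalso; omega)

/-- **The final rows**: `β_0, …, β_{N-1}` on the levels `0, …, N-1`. [cite: GrimmettManolescu2014Isoradial, §6.3] -/
theorem rowV_final {y : ℤ} (hy0 : 0 ≤ y) (hy : y < V.N) : V.rowV V.N 0 y = V.β y.toNat := by
  unfold rowV
  push_cast
  split_ifs <;> first | rfl | (exfalso; omega) | (congr 1; omega)

/-! ### Time-indexed data -/

/-- The exchange data at time `t = kN + s`. [cite: GrimmettManolescu2014Isoradial, §6.3] -/
@[reducible] def Dt (t : ℕ) : ExchangeData := V.DV (t / V.N) (t % V.N)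

/-- The canonical weights of the strip at time `t` (`t ≤ N²`). [cite: GrimmettManolescu2014Isoradial, §6.3] -/
def weightsT (t : ℕ) : Sym2 SV → unitInterval := canonicalWeight V.M fun i y => V.rowV (t / V.N) (t % V.N) y - V.α i

/-- The weights at time `t` are the initial weights of the exchange at time `t`. [folklore] -/
theorem weightsT_eq (t : ℕ) : V.weightsT t = (V.Dt t).initial := rfl

/-- **The exchanged weights at time `t` are the weights at time `t + 1`.** [cite: GrimmettManolescu2014Isoradial, §6.3] -/
theorem exchanged_Dt {t : ℕ} (ht : t < V.N * V.N) : (V.Dt t).exchanged = V.weightsT (t + 1) := by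
  have hN : 0 < V.N := Nat.pos_of_ne_zero fun h => by rw [h] at ht; simp at ht
  have hs : t % V.N < V.N := Nat.mod_lt _ hN
  show canonicalWeight V.M (fun i y => (V.DV (t / V.N) (t % V.N)).βExchanged y - V.α i) = _
  rw [V.βExchanged_DV hs]
  unfold weightsT
  congr 1
  funext i y
  congr 1
  -- the indices of time `t + 1`
  by_cases h : t % V.N + 1 < V.N
  · have h2 : (t + 1) % V.N = t % V.N + 1 := by
      rw [Nat.add_mod, Nat.one_mod_eq_one.mpr (by omega)]
      exact Nat.mod_eq_of_lt h
    have h1 : (t + 1) / V.N = t / V.N := by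
      rw [Nat.succ_div, if_neg (fun hd => ?_), Nat.add_zero]
      have := Nat.mod_eq_zero_of_dvd hd
      omega
    rw [h1, h2]
  · have hs' : t % V.N + 1 = V.N := by omega
    have hdvd : V.N ∣ t + 1 := by
      have := Nat.div_add_mod t V.N
      exact ⟨t / V.N + 1, by rw [Nat.mul_add, mul_one]; omega⟩
    have h1 : (t + 1) / V.N = t / V.N + 1 := by
      rw [Nat.succ_div, if_pos hdvd]
    have h2 : (t + 1) % V.N = 0 := Nat.mod_eq_zero_of_dvd hdvd
    rw [h1, h2, hs', V.rowV_block]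

/-- The noise of one exchange. [folklore] -/
abbrev Noise : Type := unitInterval × (Fin (2 * V.M) → unitInterval)

/-- The law of the noise of one exchange: `1 + 2M` independent uniform variables. [folklore] -/
def ν : Measure V.Noise := (volume : Measure unitInterval).prod (Measure.pi fun _ : Fin (2 * V.M) => (volume : Measure unitInterval))

/-- `ν` is a probability measure. [folklore] -/
instance : IsProbabilityMeasure V.ν := by unfold ν; infer_instance

/-- **The exchange at time `t` on configurations**, in whichever direction the angles dictate. [cite: GrimmettManolescu2014Isoradial, §6.3] -/
def stepV (t : ℕ) (ω : Set (Sym2 SV)) (r : V.Noise) : Set (Sym2 SV) := (V.Dt t).sweep₂ ω r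

/-- The exchange at time `t` is jointly measurable. [folklore] -/
theorem measurable_stepV (t : ℕ) : Measurable (Function.uncurry (V.stepV t)) := (V.Dt t).measurable_sweep₂

/-- **Hypotheses of the vertical transport**: `0 < ε`, a nonempty strip and regular block, and the
bounded-angles condition BAC(ε) on the strip for the regular angle and every irregular one.
[cite: GrimmettManolescu2014Isoradial, §6.3] -/
structure Valid (ε : ℝ) : Prop where
  /-- `0 < ε` -/
  ε_pos : 0 < ε
  /-- the strip is nonempty -/
  M_pos : 0 < V.M
  /-- the regular block is nonempty -/
  N_pos : 0 < V.N
  /-- bounded angles for the regular tracks -/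
  ξα : ∀ i : ℤ, -(V.M : ℤ) ≤ i → i < V.M → V.ξ - V.α i ∈ Set.Icc ε (π - ε)
  /-- bounded angles for the irregular tracks -/
  βα : ∀ (k : ℕ) (i : ℤ), -(V.M : ℤ) ≤ i → i < V.M → V.β k - V.α i ∈ Set.Icc ε (π - ε)

variable {V}

/-- `ε < π/2` under the hypotheses (the interval `[ε, π - ε]` is inhabited). [folklore] -/
theorem Valid.ε_lt {ε : ℝ} (hV : V.Valid ε) : ε ≤ π - ε := by
  have hM : (0 : ℤ) < V.M := by exact_mod_cast hV.M_pos
  have := hV.ξα 0 (by omega) hM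
  exact this.1.trans this.2

/-- **Every exchange of the process is two-sided valid.** [cite: GrimmettManolescu2014Isoradial, §6.3] -/
theorem Dt_valid₂ {ε : ℝ} (hV : V.Valid ε) (t : ℕ) : (V.Dt t).Valid₂ := by
  have hN : 0 < V.N := hV.N_pos
  have hs : t % V.N < V.N := Nat.mod_lt _ hN
  have hε := hV.ε_pos
  refine ⟨hV.M_pos, fun i hi hi' => ?_, fun i hi hi' => ?_⟩
  · rw [V.DV_lo]
    have := hV.ξα i hi hi'
    exact ⟨by linarith [this.1], by linarith [this.2]⟩
  · rw [V.DV_up hs]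
    have := hV.βα (t % V.N) i hi hi'
    exact ⟨by linarith [this.1], by linarith [this.2]⟩

/-- The bounded-angles hypothesis of the designated-move estimates, at every time. [folklore] -/
theorem Dt_bac {ε : ℝ} (hV : V.Valid ε) (t : ℕ) :
    ∀ i : ℤ, -((V.Dt t).M : ℤ) ≤ i → i < (V.Dt t).M →
      (V.Dt t).lo - (V.Dt t).α i ∈ Set.Icc ε (π - ε) ∧ (V.Dt t).up - (V.Dt t).α i ∈ Set.Icc ε (π - ε) := by
  have hN : 0 < V.N := hV.N_pos
  have hs : t % V.N < V.N := Nat.mod_lt _ hN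
  intro i hi hi'
  rw [V.DV_lo, V.DV_up hs]
  exact ⟨hV.ξα i hi hi', hV.βα _ i hi hi'⟩

/-- **The law of one exchange of the process**: `P_t ⊗ noise ↦ P_{t+1}`. [cite: GrimmettManolescu2014Isoradial, §6.3] -/
theorem map_stepV {ε : ℝ} (hV : V.Valid ε) {t : ℕ} (ht : t < V.N * V.N) :
    ((prodBernoulli (V.weightsT t)).prod V.ν).map (Function.uncurry (V.stepV t)) = prodBernoulli (V.weightsT (t + 1)) := by
  rw [← V.exchanged_Dt ht, weightsT_eq]
  exact ExchangeData.map_sweep₂ (Dt_valid₂ hV t)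

end VData

end TrackExchange

end Literature.Probability.Percolation
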